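import Summits.Parity.GeneralizedHardyLittlewood.Theses.LeeYangFibres
import Summits.Parity.GeneralizedHardyLittlewood.Theorems.LeeYangFibresCellsToRelativeDimOneCounts
import Summits.Parity.GeneralizedHardyLittlewood.Theorems.LeeYangFibresRelativeDimOne
import Summits.Parity.GeneralizedHardyLittlewood.Theorems.LeeYangFibresPrimeCellsRelativeCellsArithUp
import HarnessLib

/-!
# Crux `PrimeCellsRelative` (stmt-Parity-14112), line `Sketch`: stub `stub_upTransfer`

The up-transfer `RelativeDimOne ⟹ PrimeCellsRelative` at a fixed number of forms `t`: the Λ-weighted `d = 1`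
Hardy–Littlewood asymptotic with Green–Tao's relative + absolute error `ε (β_∞ ∏_p β_p + N)` gives back the
counting asymptotic for the rough prime cells `C = #{n ∈ K ∩ [-N, N] : every ψᵢ(n) a prime > N^{1/u}}`,
`|C - β_∞ ∏_p β_p (A₁/N)^t| ≤ ε (β_∞ ∏_p β_p (A₁/N)^t + N / log^t N)`, `A₁ = #{N^{1/u} < p ≤ N}`, for EVERY
`u ≥ 2`, uniformly over nondegenerate systems of size `≤ L` and convex `K ⊆ [-N, N]`.

## Proof (Green–Tao's sketch after (1.8), run forwards with the relative input)

At a scale `N` put `ℓ = log N`, `T = ℓ^t`, `Y = N/ℓ^{t+1}`, `a = ε₀/16`, `ε₀ = min ε 1`.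
* the SANDWICH `vonMangoldtSum_primePointCount_sandwich` (`Literature/…/LinearEquationsInPrimesCountSandwich`)
  gives `g, β, γ ≥ 0` with `((1-η)ℓ)^t g ≤ S ≤ ((1+η)ℓ)^t (g + β + γ)`, `g ≤ P ≤ g + β`,
  `β ≤ t(2Y+1)`, `γ ≤ t √(2LN) log₂(2LN)` (`P` = prime points, `S = ∑ ∏ Λ`);
* cells versus prime points: `C ≤ P ≤ C + t(2N^{1/u}+1)` (`card_cells_le_primePointCount`,
  `primePointCount_le_card_cells_add` of `Theorems/LeeYangFibresCellsToRelativeDimOneCounts`);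
* `T β, T γ, T β₂ = o(N)` (`eventually_log_growth`), `κ = (A₁ ℓ/N)^t ∈ [(1-η)^t, (1+η)^t]` by the prime
  number theorem (`eventually_primeCounting_window`, PROVED in the tree, and `π(N) - √N ≤ A₁ ≤ π(N)`);
* the relative input `|S - M| ≤ a (M + N)` and the arithmetic lemma `stub_cellsArithUp`
  (`Theorems/LeeYangFibresPrimeCellsRelativeCellsArithUp`, landed) give
  `|T C - κ M| ≤ ε (κ M + N)`; divide by `T`.

References: B. Green, T. Tao, *Linear equations in primes*, Ann. of Math. 171 (2010), Conj. 1.4 and the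
sketch proof after (1.8) [GreenTao2010]; H. L. Montgomery, R. C. Vaughan, *Multiplicative Number Theory I*
(2007), §8.1 [MontgomeryVaughan2007].
-/

noncomputable section

namespace Summit.Parity.GeneralizedHardyLittlewood.Cruxes.PrimeCellsRelative.Sketch

open scoped BigOperators Topology Classical
open Filter Finset Asymptotics Literature.NumberTheory.Sieve
open Summit.Parity.GeneralizedHardyLittlewood.Theorems.LeeYangFibresCells

/-- **Main step at one scale `N` (the up direction).** Under the growth conditions on `ℓ = log N` listed as
hypotheses (all eventually true), the comparison `C ≤ P ≤ C + t(2N^{1/u}+1)` of the cell count `Cn` with the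
prime-point count, the window `π(N) - N^{1/u} ≤ A₁ ≤ π(N)` for the rough prime count and the RELATIVE von
Mangoldt asymptotic `|∑ ∏ Λ(ψᵢ(n)) - M| ≤ (ε₀/16)(M + N)`, one has
`|Cn - M (A₁/N)^t| ≤ ε (M (A₁/N)^t + N/ℓ^t)`. (`Cn, A₁, M` are real parameters.)
[cite: GreenTao2010, Conj. 1.4 (sketch proof)] -/
theorem abs_cells_sub_le_of_vonMangoldtSum {t L N u : ℕ} {ε ε₀ η c₂ Cn A₁ M : ℝ}
    (Ψ : Fin t → AffLinForm 1) (K : Set (Fin 1 → ℝ)) (ht : 1 ≤ t) (hN3 : 3 ≤ N) (hu2 : 2 ≤ u)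
    (hε₀ : 0 < ε₀) (hε₀1 : ε₀ ≤ 1) (hε₀ε : ε₀ ≤ ε) (hη2 : η ≤ 1 / 2)
    (hηp : (1 + η) ^ t ≤ 1 + ε₀ / 16) (hηm : 1 - ε₀ / 16 ≤ (1 - η) ^ t)
    (hΨ : IsNondegenerateSystem Ψ) (hL : affLinSize Ψ N ≤ L) (hc₂0 : 0 < c₂)
    (hc₂ : 12 * t * (Real.sqrt (2 * L) + 1) * c₂ ≤ ε₀ / 16)
    (hℓL : Real.log (2 * L) ≤ η * Real.log N) (hℓt : 144 * t ≤ ε₀ * Real.log N)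
    (hloglog : (t + 1 : ℝ) * Real.log (Real.log N) ≤ η * Real.log N)
    (hℓpow : Real.log N ^ (t + 1) ≤ 1 * N) (hℓsqrt : Real.log N ^ (t + 1) ≤ c₂ * Real.sqrt N)
    (hwin : ∀ A : ℝ, (Nat.primeCounting N : ℝ) - Real.sqrt N ≤ A → A ≤ Nat.primeCounting N →
      (1 - η) * N ≤ A * Real.log N ∧ A * Real.log N ≤ (1 + η) * N)
    (hSM : |vonMangoldtSum Ψ K N - M| ≤ ε₀ / 16 * (M + N))
    (hC0 : 0 ≤ Cn) (hC1 : Cn ≤ primePointCount Ψ K N)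
    (hC2 : (primePointCount Ψ K N : ℝ) ≤ Cn + t * (2 * (N : ℝ) ^ ((1 : ℝ) / u) + 1))
    (hA1 : (Nat.primeCounting N : ℝ) ≤ A₁ + (N : ℝ) ^ ((1 : ℝ) / u))
    (hA2 : A₁ ≤ Nat.primeCounting N) :
    |Cn - M * (A₁ / N) ^ t| ≤ ε * (M * (A₁ / N) ^ t + N / Real.log N ^ t) := by
  have hN1 : 1 ≤ N := by omega
  have hx1 : (1 : ℝ) ≤ N := by exact_mod_cast hN1
  have hx3 : (3 : ℝ) ≤ N := by exact_mod_cast hN3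
  have hx0 : (0 : ℝ) < N := by linarith
  have ht0 : (0 : ℝ) < t := by exact_mod_cast ht
  have hℓ1 : 1 < Real.log N := by
    rw [Real.lt_log_iff_exp_lt hx0]
    linarith [Real.exp_one_lt_d9]
  set ℓ : ℝ := Real.log N with hℓdef
  have hℓ0 : 0 < ℓ := by linarith
  set T : ℝ := ℓ ^ t with hTdef
  have hT : 0 < T := pow_pos hℓ0 t
  have hℓt1 : 0 < ℓ ^ (t + 1) := pow_pos hℓ0 _
  have hTℓ : T * ℓ = ℓ ^ (t + 1) := by rw [hTdef, pow_succ]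
  have hTle : T ≤ ℓ ^ (t + 1) := by
    rw [← hTℓ]
    exact le_mul_of_one_le_right hT.le hℓ1.le
  obtain ⟨i₀⟩ : Nonempty (Fin t) := ⟨⟨0, ht⟩⟩
  have hL1 : (1 : ℝ) ≤ L := one_le_of_affLinSize_le Ψ hΨ hL i₀
  have hηℓ : η * ℓ ≤ 1 / 2 * ℓ := mul_le_mul_of_nonneg_right hη2 hℓ0.le
  -- the threshold `Y = N / ℓ^{t+1}`
  set Y : ℝ := N / ℓ ^ (t + 1) with hYdef
  have hY1 : 1 ≤ Y := by
    rw [hYdef, le_div_iff₀ hℓt1, one_mul]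
    linarith
  have hY0 : 0 < Y := by linarith
  have hlogY : (1 - η) * ℓ ≤ Real.log Y := by
    rw [hYdef, Real.log_div hx0.ne' hℓt1.ne', Real.log_pow, ← hℓdef]
    push_cast
    linarith
  have ha0' : 0 ≤ (1 - η) * ℓ := mul_nonneg (by linarith) hℓ0.le
  have hb : Real.log (2 * L * N) ≤ (1 + η) * ℓ := by
    rw [Real.log_mul (by positivity) hx0.ne', ← hℓdef]
    linarith
  -- the sandwich
  obtain ⟨g, β, γ, hg, hβ, hγ, hS1, hS2, hP1, hP2, hβle, hγle⟩ :=
    vonMangoldtSum_primePointCount_sandwich hN1 Ψ hΨ hL K ht hY1 ha0' hlogY hb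
  simp only [Nat.sub_self, pow_zero, mul_one] at hβle hγle
  -- `Z = N^{1/u} ≤ √N` and the PNT window for `A₁`
  have hZ : (N : ℝ) ^ ((1 : ℝ) / u) ≤ Real.sqrt N := by
    rw [Real.sqrt_eq_rpow]
    refine Real.rpow_le_rpow_of_exponent_le hx1 ?_
    have hu : (2 : ℝ) ≤ u := by exact_mod_cast hu2
    exact one_div_le_one_div_of_le two_pos hu
  have hZ0 : 0 ≤ (N : ℝ) ^ ((1 : ℝ) / u) := by positivity
  obtain ⟨hAlo, hAhi⟩ := hwin A₁ (by linarith only [hA1, hZ]) hA2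
  have hA0 : 0 ≤ A₁ := by
    refine le_of_mul_le_mul_right ?_ hℓ0
    have : 0 ≤ (1 - η) * (N : ℝ) := mul_nonneg (by linarith only [hη2]) hx0.le
    linarith only [this, hAlo]
  -- `κ = (A₁ ℓ / N)^t ∈ [1 - ε₀/16, 1 + ε₀/16]`
  set κ : ℝ := (A₁ / N) ^ t * T with hκdef
  have hκeq : κ = (A₁ * ℓ / N) ^ t := by
    rw [hκdef, hTdef, ← mul_pow, div_mul_eq_mul_div]
  have hκlo : 1 - ε₀ / 16 ≤ κ := by
    rw [hκeq]
    refine hηm.trans (pow_le_pow_left₀ (by linarith only [hη2]) ?_ t)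
    rw [le_div_iff₀ hx0]
    linarith only [hAlo]
  have hκhi : κ ≤ 1 + ε₀ / 16 := by
    rw [hκeq]
    refine le_trans (pow_le_pow_left₀ (div_nonneg (mul_nonneg hA0 hℓ0.le) hx0.le) ?_ t) hηp
    rw [div_le_iff₀ hx0]
    linarith only [hAhi]
  -- smallness of the three error counts
  have hYℓ : Y * ℓ ^ (t + 1) = N := div_mul_cancel₀ _ hℓt1.ne'
  have hTY : T * Y * ℓ = N := by
    calc T * Y * ℓ = Y * (T * ℓ) := by ring
      _ = Y * ℓ ^ (t + 1) := by rw [hTℓ]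
      _ = N := hYℓ
  have hEb : T * β ≤ ε₀ / 48 * N := by
    have h1 : T * β ≤ 3 * t * (T * Y) := by
      calc T * β ≤ T * (t * (2 * Y + 1)) := mul_le_mul_of_nonneg_left hβle hT.le
        _ ≤ T * (t * (3 * Y)) :=
            mul_le_mul_of_nonneg_left (mul_le_mul_of_nonneg_left (by linarith only [hY1]) ht0.le)
              hT.le
        _ = 3 * t * (T * Y) := by ring
    have h2 : 3 * t * (T * Y) * ℓ ≤ ε₀ / 48 * N * ℓ := by
      calc 3 * t * (T * Y) * ℓ = 3 * t * (T * Y * ℓ) := by ring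
        _ = 3 * t * N := by rw [hTY]
        _ = (144 * t) * N / 48 := by ring
        _ ≤ (ε₀ * ℓ) * N / 48 :=
            div_le_div_of_nonneg_right (mul_le_mul_of_nonneg_right hℓt hx0.le) (by norm_num)
        _ = ε₀ / 48 * N * ℓ := by ring
    have h3 : 3 * t * (T * Y) ≤ ε₀ / 48 * N := le_of_mul_le_mul_right h2 hℓ0
    exact h1.trans h3
  have hsx : Real.sqrt N * Real.sqrt N = N := Real.mul_self_sqrt hx0.le
  have hs1 : 1 ≤ Real.sqrt (N : ℝ) := by
    rw [show (1 : ℝ) = Real.sqrt 1 from Real.sqrt_one.symm]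
    exact Real.sqrt_le_sqrt hx1
  have hEc : T * γ ≤ ε₀ / 48 * N := by
    have hs : (Nat.sqrt (2 * L * N) : ℝ) ≤ Real.sqrt (2 * L) * Real.sqrt N := by
      have h1 := Real.nat_sqrt_le_real_sqrt (a := 2 * L * N)
      push_cast at h1
      rwa [Real.sqrt_mul (by positivity)] at h1
    have hlg : (Nat.log 2 (2 * L * N) : ℝ) ≤ 4 * ℓ := by
      have h1 : ((Nat.log 2 (2 * L * N) : ℕ) : ℝ) ≤ Real.logb 2 (2 * L * N) := by
        have := Real.natLog_le_logb (2 * L * N) 2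
        exact_mod_cast this
      have h2 : Real.logb 2 (2 * (L : ℝ) * N) ≤ 4 * ℓ := by
        rw [Real.logb, div_le_iff₀ (Real.log_pos one_lt_two)]
        have h3 : Real.log (2 * L * N) ≤ 2 * ℓ := hb.trans (by linarith only [hηℓ, hℓ0])
        have h4 := Real.log_two_gt_d9
        have h5 : 1 / 2 * ℓ ≤ Real.log 2 * ℓ :=
          mul_le_mul_of_nonneg_right (by linarith only [h4]) hℓ0.le
        linarith only [h3, h5, hℓ0]
      exact h1.trans h2
    have hkey : 4 * t * Real.sqrt (2 * L) * c₂ ≤ ε₀ / 48 := by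
      have h1 : 4 * t * Real.sqrt (2 * L) * c₂ ≤ 4 * t * (Real.sqrt (2 * L) + 1) * c₂ :=
        mul_le_mul_of_nonneg_right
          (mul_le_mul_of_nonneg_left (by linarith only) (by positivity)) hc₂0.le
      linarith only [h1, hc₂]
    calc T * γ
        ≤ T * (t * ((Nat.sqrt (2 * L * N) : ℝ) * (Nat.log 2 (2 * L * N) : ℝ))) :=
          mul_le_mul_of_nonneg_left hγle hT.le
      _ ≤ T * (t * (Real.sqrt (2 * L) * Real.sqrt N * (4 * ℓ))) :=
          mul_le_mul_of_nonneg_left (mul_le_mul_of_nonneg_left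
            (mul_le_mul hs hlg (Nat.cast_nonneg _) (by positivity)) ht0.le) hT.le
      _ = 4 * t * Real.sqrt (2 * L) * Real.sqrt N * (T * ℓ) := by ring
      _ ≤ 4 * t * Real.sqrt (2 * L) * Real.sqrt N * (c₂ * Real.sqrt N) := by
          refine mul_le_mul_of_nonneg_left ?_ (by positivity)
          rw [hTℓ]
          exact hℓsqrt
      _ = 4 * t * Real.sqrt (2 * L) * c₂ * (Real.sqrt N * Real.sqrt N) := by ring
      _ = 4 * t * Real.sqrt (2 * L) * c₂ * N := by rw [hsx]
      _ ≤ ε₀ / 48 * N := mul_le_mul_of_nonneg_right hkey hx0.le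
  have hEb2 : T * (t * (2 * (N : ℝ) ^ ((1 : ℝ) / u) + 1)) ≤ ε₀ / 64 * N := by
    have hkey : 3 * t * c₂ ≤ ε₀ / 64 := by
      have h0 : 0 ≤ Real.sqrt (2 * (L : ℝ)) := Real.sqrt_nonneg _
      have h1 : 3 * t * c₂ ≤ 3 * t * (Real.sqrt (2 * L) + 1) * c₂ := by
        have h2 : 3 * (t : ℝ) * 1 ≤ 3 * t * (Real.sqrt (2 * L) + 1) :=
          mul_le_mul_of_nonneg_left (by linarith only [h0]) (by positivity)
        have := mul_le_mul_of_nonneg_right h2 hc₂0.le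
        linarith only [this]
      linarith only [h1, hc₂]
    calc T * (t * (2 * (N : ℝ) ^ ((1 : ℝ) / u) + 1))
        ≤ T * (t * (2 * Real.sqrt N + Real.sqrt N)) :=
          mul_le_mul_of_nonneg_left (mul_le_mul_of_nonneg_left (by linarith only [hZ, hs1]) ht0.le)
            hT.le
      _ = 3 * t * Real.sqrt N * T := by ring
      _ ≤ 3 * t * Real.sqrt N * (c₂ * Real.sqrt N) :=
          mul_le_mul_of_nonneg_left (hTle.trans hℓsqrt) (by positivity)
      _ = 3 * t * c₂ * (Real.sqrt N * Real.sqrt N) := by ring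
      _ = 3 * t * c₂ * N := by rw [hsx]
      _ ≤ ε₀ / 64 * N := mul_le_mul_of_nonneg_right hkey hx0.le
  -- feed the arithmetic lemma: `|T Cn - M κ| ≤ ε (M κ + N)`
  have hlo : (1 - ε₀ / 16) * T ≤ ((1 - η) * ℓ) ^ t := by
    rw [mul_pow]
    exact mul_le_mul_of_nonneg_right hηm hT.le
  have hhi : ((1 + η) * ℓ) ^ t ≤ (1 + ε₀ / 16) * T := by
    rw [mul_pow]
    exact mul_le_mul_of_nonneg_right hηp hT.le
  have key : |T * Cn - M * κ| ≤ ε * (M * κ + N) := by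
    refine stub_cellsArithUp (Tg := T * g) (Tb := T * β) (Tc := T * γ)
      (Tb2 := T * (t * (2 * (N : ℝ) ^ ((1 : ℝ) / u) + 1))) (TC := T * Cn) (MK := M * κ)
      hε₀ hε₀1 hε₀ε hx0 (mul_nonneg hT.le hg) (mul_nonneg hT.le hβ) (mul_nonneg hT.le hγ)
      (by positivity) (mul_nonneg hT.le hC0) ?_ ?_ ?_ ?_ hSM ?_ ?_ ?_
    · -- lower sandwich
      calc (1 - ε₀ / 16) * (T * g) = (1 - ε₀ / 16) * T * g := by ring
        _ ≤ ((1 - η) * ℓ) ^ t * g := mul_le_mul_of_nonneg_right hlo hg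
        _ ≤ _ := hS1
    · -- upper sandwich
      calc vonMangoldtSum Ψ K N ≤ ((1 + η) * ℓ) ^ t * (g + β + γ) := hS2
        _ ≤ (1 + ε₀ / 16) * T * (g + β + γ) :=
            mul_le_mul_of_nonneg_right hhi (by linarith only [hg, hβ, hγ])
        _ = (1 + ε₀ / 16) * (T * g + T * β + T * γ) := by ring
    · -- `T Cn - T β ≤ T g`
      have h1 : Cn - β ≤ g := by linarith only [hC1, hP2]
      have h2 := mul_le_mul_of_nonneg_left h1 hT.le
      linarith only [h2]
    · -- `T g ≤ T Cn + T β₂`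
      have h1 : g ≤ Cn + t * (2 * (N : ℝ) ^ ((1 : ℝ) / u) + 1) := by linarith only [hP1, hC2]
      have h2 := mul_le_mul_of_nonneg_left h1 hT.le
      linarith only [h2]
    · intro hM
      constructor
      · have := mul_le_mul_of_nonneg_left hκlo hM
        linarith only [this]
      · have := mul_le_mul_of_nonneg_left hκhi hM
        linarith only [this]
    · intro hM
      constructor
      · have := mul_le_mul_of_nonpos_left hκhi hM.le
        linarith only [this]
      · have := mul_le_mul_of_nonpos_left hκlo hM.le
        linarith only [this]
    · have hεN : 0 ≤ ε₀ * N := by positivity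
      linarith only [hEb, hEc, hEb2, hεN]
  -- divide by `T = ℓ^t`
  have h2 : T * |Cn - M * (A₁ / N) ^ t| = |T * Cn - M * κ| := by
    rw [← abs_of_pos hT, ← abs_mul, abs_of_pos hT]
    congr 1
    rw [hκdef]
    ring
  have hTN : T * (N / T) = N := mul_div_cancel₀ _ hT.ne'
  have h3 : T * (ε * (M * (A₁ / N) ^ t + N / T)) = ε * (M * κ + N) := by
    calc T * (ε * (M * (A₁ / N) ^ t + N / T))
        = ε * (M * ((A₁ / N) ^ t * T) + T * (N / T)) := by ring
      _ = ε * (M * κ + N) := by rw [hTN]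
  refine le_of_mul_le_mul_left ?_ hT
  rw [h2, h3]
  exact key

/-- **Registered stub `stub_upTransfer` of the line `Sketch`** (crux stmt-Parity-14112): the up-transfer
`RelativeDimOne ⟹ PrimeCellsRelative` at `t` forms, with `u = 2` (any `u ≥ 2` works:
`abs_cells_sub_le_of_vonMangoldtSum`). [cite: GreenTao2010, Conj. 1.4 (sketch proof)] -/
theorem stub_upTransfer (t : ℕ) (ht : 1 ≤ t)
    (hR : ∀ L : ℕ, ∀ ε : ℝ, 0 < ε → ∃ N₀ : ℕ, ∀ N : ℕ, N₀ ≤ N → ∀ Ψ : Fin t → Literature.NumberTheory.Sieve.AffLinForm 1, Literature.NumberTheory.Sieve.IsNondegenerateSystem Ψ → Literature.NumberTheory.Sieve.affLinSize Ψ N ≤ L → ∀ K : Set (Fin 1 → ℝ), Convex ℝ K → K ⊆ Literature.NumberTheory.Sieve.realBox 1 N → |Literature.NumberTheory.Sieve.vonMangoldtSum Ψ K N - Literature.NumberTheory.Sieve.archFactor Ψ K * Literature.NumberTheory.Sieve.singularProduct Ψ| ≤ ε * (Literature.NumberTheory.Sieve.archFactor Ψ K * Literature.NumberTheory.Sieve.singularProduct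 Ψ + N)) :
    ∀ L : ℕ, ∀ ε : ℝ, 0 < ε → ∃ u : ℕ, 2 ≤ u ∧ ∃ N₀ : ℕ, ∀ N : ℕ, N₀ ≤ N → ∀ Ψ : Fin t → Literature.NumberTheory.Sieve.AffLinForm 1, Literature.NumberTheory.Sieve.IsNondegenerateSystem Ψ → Literature.NumberTheory.Sieve.affLinSize Ψ N ≤ L → ∀ K : Set (Fin 1 → ℝ), Convex ℝ K → K ⊆ Literature.NumberTheory.Sieve.realBox 1 N → |((((Literature.NumberTheory.Sieve.latticeBox 1 N).filter (fun n => Literature.NumberTheory.Sieve.realPoint n ∈ K ∧ ∀ i, (N : ℝ) ^ ((1 : ℝ) / u) < (Nat.minFac ((Ψ i).eval n).toNat : ℝ) ∧ ArithmeticFunction.cardFactors ((Ψ i).eval n).toNat = 1)).card : ℕ) : ℝ) - Literature.NumberTheory.Sieve.archFactor Ψ K * Literature.NumberTheory.Sieve.singularProduct Ψ * (((((Finset.Icc 1 N).filter (fun m => (N : ℝ) ^ ((1 : ℝ) / u) < (Nat.minFac m : ℝ) ∧ ArithmeticFunction.cardFactors m = 1)).card : ℕ) : ℝ) / N) ^ t|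 ≤ ε * (Literature.NumberTheory.Sieve.archFactor Ψ K * Literature.NumberTheory.Sieve.singularProduct Ψ * (((((Finset.Icc 1 N).filter (fun m => (N : ℝ) ^ ((1 : ℝ) / u) < (Nat.minFac m : ℝ) ∧ ArithmeticFunction.cardFactors m = 1)).card : ℕ) : ℝ) / N) ^ t + N / Real.log N ^ t) := by
  intro L ε hε
  -- precision bookkeeping: `ε₀ = min ε 1`, `η = η(ε₀/16)`, `RelativeDimOne` at precision `ε₀/16`
  set ε₀ : ℝ := min ε 1 with hε₀def
  have hε₀ : 0 < ε₀ := lt_min hε one_pos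
  have hε₀1 : ε₀ ≤ 1 := min_le_right _ _
  have hε₀ε : ε₀ ≤ ε := min_le_left _ _
  have ha0 : 0 < ε₀ / 16 := by positivity
  obtain ⟨η, hη0, hη2, hηp, hηm⟩ := exists_eta_pow_near_one t ha0
  obtain ⟨N₁, hN₁⟩ := hR L (ε₀ / 16) ha0
  obtain ⟨N₂, hN₂⟩ := Filter.eventually_atTop.mp (eventually_primeCounting_window hη0)
  -- growth conditions on the scale
  have hden : (0 : ℝ) < 12 * t * (Real.sqrt (2 * L) + 1) := by
    have ht0 : (0 : ℝ) < t := by exact_mod_cast ht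
    positivity
  set c₂ : ℝ := ε₀ / 16 / (12 * t * (Real.sqrt (2 * L) + 1)) with hc₂def
  have hc₂0 : 0 < c₂ := div_pos ha0 hden
  have hc₂ : 12 * t * (Real.sqrt (2 * L) + 1) * c₂ ≤ ε₀ / 16 := by
    rw [hc₂def, mul_div_cancel₀ _ hden.ne']
  obtain ⟨N₃, hN₃⟩ := Filter.eventually_atTop.mp (eventually_log_growth t
    (max (Real.log (2 * L) / η) (144 * t / ε₀)) hη0 one_pos hc₂0)
  refine ⟨2, le_rfl, max N₁ (max N₂ (max N₃ 3)), fun N hN Ψ hΨ hL K hK hKN => ?_⟩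
  have hNN₁ : N₁ ≤ N := le_trans (le_max_left _ _) hN
  have hNN₂ : N₂ ≤ N := le_trans ((le_max_left _ _).trans (le_max_right _ _)) hN
  have hNN₃ : N₃ ≤ N :=
    le_trans ((le_max_left _ _).trans ((le_max_right _ _).trans (le_max_right _ _))) hN
  have hN3 : 3 ≤ N :=
    le_trans ((le_max_right _ _).trans ((le_max_right _ _).trans (le_max_right _ _))) hN
  obtain ⟨hCℓ, hloglog, hℓpow, hℓsqrt⟩ := hN₃ N hNN₃
  have hℓL : Real.log (2 * L) ≤ η * Real.log N := by
    have h1 : Real.log (2 * L) / η ≤ Real.log N := (le_max_left _ _).trans hCℓ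
    rw [div_le_iff₀ hη0] at h1
    linarith
  have hℓt : 144 * t ≤ ε₀ * Real.log N := by
    have h1 : 144 * t / ε₀ ≤ Real.log N := (le_max_right _ _).trans hCℓ
    rw [div_le_iff₀ hε₀] at h1
    linarith
  have hZ0 : 0 ≤ (N : ℝ) ^ ((1 : ℝ) / (2 : ℕ)) := by positivity
  exact abs_cells_sub_le_of_vonMangoldtSum Ψ K ht hN3 le_rfl hε₀ hε₀1 hε₀ε hη2 hηp hηm hΨ hL hc₂0
    hc₂ hℓL hℓt hloglog hℓpow hℓsqrt (hN₂ N hNN₂) (hN₁ N hNN₁ Ψ hΨ hL K hK hKN) (Nat.cast_nonneg _)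
    (card_cells_le_primePointCount N _ Ψ K) (primePointCount_le_card_cells_add hZ0 Ψ hΨ K)
    (primeCounting_le_card_roughPrimes_add N hZ0) (card_roughPrimes_le_primeCounting N _)

end Summit.Parity.GeneralizedHardyLittlewood.Cruxes.PrimeCellsRelative.Sketch

end
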